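import Literature.Analysis.FluidPDE.KwonLocalLerayDuality
import Literature.Analysis.FluidPDE.KwonTestFieldCalculus
import Literature.Analysis.FluidPDE.RieszPressureSpaceTimeLp
import Literature.Analysis.FluidPDE.TruncatedNewtonHessian
import HarnessLib

/-!
# Kwon's Lemma 2.5: the Calderón–Zygmund pressure piece `Δ⁻¹ div div (φ u ⊗ u)` via the Riesz
# pressure operator

Analysis/FluidPDE file on the discharge path of the named fact
`Literature.Analysis.FluidPDE.kwon2023_velocity_epsilon_regularity`
(`PressureFreeEpsilonRegularity.lean`; H. Kwon, J. Differential Equations (2023) =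
arXiv:2104.03160, Thm. 1.4), eighth brick of Lemma 2.5. In the convective term tested with
`ζ_ξ = −curl(φ curl A_ξ)` the only non-smooth piece is the Calderón–Zygmund term
`∫ φ u ⊗ u : ∇² div A_ξ = ∫ φ D²Π_ξ(u, u)`, `Π_ξ = div A_ξ` (isolated in
`KwonConvectiveTransposes.sum_integral_inner_gradient_cutoff_mul_divergence`); Kwon estimates it in
`L^{3/2}` ("`‖Δ⁻¹div(φ ω × u)‖_{L^{3/2}} ≲ ‖u‖²_{L³}`", (est.q)). Here it is written as
`−∫ q₀ div ξ` with an **explicit `L^{3/2}` function `q₀` of the slice**, using the tree's Riesz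
pressure OPERATOR `Π : L³ → L^{3/2}` (`RieszPressureL3.rieszPressure`, from the proved Stein
bound; weak Poisson equation `∫ Π[W] Δψ = −∫ D²ψ(W, W)`, `integral_rieszPressure_mul_laplacian`):

* `divergence_testPotential_eq_newtonNearPotential`: `div A_ξ = N[div ξ]`, `N = N_{3,4}` the
  truncated Newtonian potential (`newtonNearPotential 3 4`); hence
  `laplacian_divergence_testPotential`: `ΔΠ_ξ = div ξ − Λ[div ξ]` (`laplacian_newtonNearPotential`,
  `Λ = Λ_{3,4}` the smoothing remainder);
* `sqrtCutoffSMul U = √φ · U =: W` (`W ⊗ W = φ U ⊗ U`, `‖W‖ ≤ ‖U‖`, `W ∈ L³`);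
* `czPressure U = Π[W] − Λ[Π[W]] =: q₀`;
* `integral_cutoff_mul_hessian_divergence_testPotential`: for `U ∈ L³(ℝ³; ℝ³)` and every test
  field `ξ`, **`∫ φ D²Π_ξ(U, U) = −∫ q₀ div ξ`** (`φD²Π_ξ(U,U) = D²Π_ξ(W,W)`, the weak Poisson
  equation with the test function `Π_ξ ∈ C_c^∞`, `ΔΠ_ξ = div ξ − Λ[div ξ]`, and the pairing
  symmetry `∫ P Λ[σ] = ∫ Λ[P] σ` for `P ∈ L¹_loc`, `integral_mul_newtonFarSmoothing_comm_loc`).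

The `L^{3/2}` bound `‖q₀‖ ≲ ‖U‖₃²` (Stein's constant, `eLpNorm_rieszPressure_le`, and Hölder for
`Λ`) and the jointly measurable space–time representative (`RieszPressureSpaceTimeLp`) are used at
the assembly of Lemma 2.5.

## Mathlib / tree search

Tree (reused): `rieszPressure`, `memLp_rieszPressure`, `integral_rieszPressure_mul_laplacian`
(`RieszPressureL3`); `newtonNearPotential(_apply)`, `newtonFarSmoothing(_eq_convolution)`,
`laplacian_newtonNearPotential`, `continuous/hasCompactSupport_newtonFarSmoothing`
(`NewtonLocalPotential`); `continuous/hasCompactSupport_newtonFarLaplacian` (`NewtonKernel`),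
`newtonFarLaplacian_neg` (`TruncatedNewtonHessian`); `integral_smul_convolution_eq`
(`MollifiedField`); `testPotential_apply_coord`, `fderiv_testPotential_apply`,
`contDiff_fderiv_apply_infty`, `testKernel_eq_zero_of_lt`, `integrable_testKernel`
(`KwonTestField(Calculus)`); `contDiff/hasCompactSupport_divergence_testPotential`
(`KwonLocalLerayDuality`); `divergence_eq_sum_inner_fderiv` (`VectorCalculus`). The tree's
`integral_mul_newtonFarSmoothing_comm` (`CKNPressureLocalizationProofs`) needs `f ∈ L¹(ℝ³)`; the
`L¹_loc` form here goes through the even-kernel adjoint identity instead.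
Mathlib: `MemLp.of_le`, `MemLp.locallyIntegrable`,
`LocallyIntegrable.integrable_smul_left_of_hasCompactSupport`,
`HasCompactSupport.continuous_convolution_left`.

## References

* H. Kwon, J. Differential Equations (2023) = arXiv:2104.03160: proof of Lemma 2.5 (arXiv p. 8),
  (est.q). [Kwon2023RolePressure]
* E. M. Stein, *Singular integrals and differentiability properties of functions* (1970), Ch. II
  §4.2 Thm. 3 (behind `rieszPressure`). [Stein1971]
-/

noncomputable section

open MeasureTheory Set Function Filter Topology TopologicalSpace Metric InnerProductSpace
  ContinuousLinearMap
open scoped NNReal ENNReal RealInnerProductSpace Convolution Laplacian ContDiff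

namespace Literature.Analysis.FluidPDE

namespace Kwon2023

variable {ξ U : EuclideanSpace ℝ (Fin 3) → EuclideanSpace ℝ (Fin 3)}

/-! ### `div A_ξ` is the truncated Newtonian potential of `div ξ` -/

/-- **`div A_ξ = N[div ξ]`** with `N = N_{3,4}` the truncated Newtonian potential of the tree
(`newtonNearPotential 3 4`): the derivative falls on `ξ` (`∂ᵢA_ξ = A_{∂ᵢξ}`,
`(A_η)ᵢ = N[ηᵢ]`) and `Σᵢ (∂ᵢξ)ᵢ = div ξ` under the integral. [folklore] -/
theorem divergence_testPotential_eq_newtonNearPotential (hξ : ContDiff ℝ ∞ ξ)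
    (hξc : HasCompactSupport ξ) (x : EuclideanSpace ℝ (Fin 3)) :
    VectorCalculus.divergence (testPotential ξ) x =
      newtonNearPotential 3 4 (fun y => VectorCalculus.divergence ξ y) x := by
  let b : OrthonormalBasis (Fin 3) ℝ (EuclideanSpace ℝ (Fin 3)) := EuclideanSpace.basisFun (Fin 3) ℝ
  have hb : ∀ (i : Fin 3) (w : EuclideanSpace ℝ (Fin 3)), ⟪b i, w⟫ = w i := fun i w => by
    simp [b, EuclideanSpace.inner_single_left]
  have hξ1 : ContDiff ℝ 1 ξ := contDiff_infty.1 hξ 1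
  have hDξ : Continuous (fderiv ℝ ξ) := hξ1.continuous_fderiv one_ne_zero
  obtain ⟨C, hC⟩ := hDξ.bounded_above_of_compact_support (hξc.fderiv (𝕜 := ℝ))
  have hkρ : ∀ z : EuclideanSpace ℝ (Fin 3), (4 : ℝ) < ‖z‖ → testKernel z = 0 :=
    fun z hz => testKernel_eq_zero_of_lt hz
  have hint : ∀ i : Fin 3, Integrable fun z => testKernel z * fderiv ℝ ξ (x - z) (b i) i := by
    intro i
    have h := integrable_smul_comp_sub (F := EuclideanSpace ℝ (Fin 3)) integrable_testKernel hkρ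
      (contDiff_fderiv_apply_infty hξ (b i)).continuous x
    have := (EuclideanSpace.proj (𝕜 := ℝ) i).integrable_comp h
    refine this.congr (Eventually.of_forall fun z => ?_)
    simp [smul_eq_mul]
  rw [divergence_eq_sum_inner_fderiv b, newtonNearPotential_apply]
  have h1 : ∀ i : Fin 3, ⟪b i, fderiv ℝ (testPotential ξ) x (b i)⟫ =
      ∫ z, testKernel z * fderiv ℝ ξ (x - z) (b i) i := fun i => by
    rw [fderiv_testPotential_apply hξ1 x (b i), hb,
      testPotential_apply_coord (contDiff_fderiv_apply_infty hξ (b i)) x i, newtonNearPotential_apply]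
    rfl
  simp_rw [h1]
  rw [← integral_finsetSum _ fun i _ => hint i]
  refine integral_congr_ae (Eventually.of_forall fun z => ?_)
  show ∑ i, testKernel z * fderiv ℝ ξ (x - z) (b i) i = newtonNear 3 4 z * VectorCalculus.divergence ξ (x - z)
  rw [← Finset.mul_sum, divergence_eq_sum_inner_fderiv b ξ (x - z)]
  simp_rw [hb]
  rfl

/-- **`Δ(div A_ξ) = div ξ − Λ[div ξ]`**, `Λ = Λ_{3,4}` the smoothing remainder of the truncated
potential (`laplacian_newtonNearPotential`). [folklore] -/
theorem laplacian_divergence_testPotential (hξ : ContDiff ℝ ∞ ξ) (hξc : HasCompactSupport ξ)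
    (x : EuclideanSpace ℝ (Fin 3)) :
    (Δ (VectorCalculus.divergence (testPotential ξ))) x =
      VectorCalculus.divergence ξ x -
        newtonFarSmoothing 3 4 (fun y => VectorCalculus.divergence ξ y) x := by
  have e : VectorCalculus.divergence (testPotential ξ) =
      newtonNearPotential 3 4 (fun y => VectorCalculus.divergence ξ y) :=
    funext (divergence_testPotential_eq_newtonNearPotential hξ hξc)
  have hσ2 : ContDiff ℝ 2 fun y => VectorCalculus.divergence ξ y := by
    rw [show (fun y => VectorCalculus.divergence ξ y) = traceCLM ∘ fderiv ℝ ξ from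
      divergence_eq_traceCLM_comp ξ]
    exact traceCLM.contDiff.comp ((contDiff_infty.1 hξ 3).fderiv_right (m := 2) (by norm_num))
  rw [e, laplacian_newtonNearPotential (by norm_num) (by norm_num) hσ2 x]

/-! ### The weighted slice `√φ u` -/

/-- `0 ≤ φ`. [folklore] -/
theorem kwonCutoff_nonneg (x : EuclideanSpace ℝ (Fin 3)) : 0 ≤ kwonCutoff x := radialCutoff_nonneg _ _ x

/-- `φ ≤ 1`. [folklore] -/
theorem kwonCutoff_le_one (x : EuclideanSpace ℝ (Fin 3)) : kwonCutoff x ≤ 1 := radialCutoff_le_one _ _ x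

variable (U) in
/-- The weighted slice `W = √φ · U`, so that `W ⊗ W = φ U ⊗ U`. [folklore] -/
def sqrtCutoffSMul (x : EuclideanSpace ℝ (Fin 3)) : EuclideanSpace ℝ (Fin 3) :=
  Real.sqrt (kwonCutoff x) • U x

/-- `D²ψ(W, W) = φ D²ψ(U, U)` pointwise. [folklore] -/
theorem hessian_sqrtCutoffSMul (B : EuclideanSpace ℝ (Fin 3) →L[ℝ] EuclideanSpace ℝ (Fin 3) →L[ℝ] ℝ)
    (x : EuclideanSpace ℝ (Fin 3)) :
    B (sqrtCutoffSMul U x) (sqrtCutoffSMul U x) = kwonCutoff x * B (U x) (U x) := by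
  simp only [sqrtCutoffSMul, map_smul, smul_apply, smul_eq_mul]
  rw [← mul_assoc, ← pow_two, Real.sq_sqrt (kwonCutoff_nonneg x)]

/-- `‖W(x)‖ ≤ ‖U(x)‖`. [folklore] -/
theorem norm_sqrtCutoffSMul_le (x : EuclideanSpace ℝ (Fin 3)) : ‖sqrtCutoffSMul U x‖ ≤ ‖U x‖ := by
  rw [sqrtCutoffSMul, norm_smul, Real.norm_eq_abs, abs_of_nonneg (Real.sqrt_nonneg _)]
  refine mul_le_of_le_one_left (norm_nonneg _) ?_
  rw [Real.sqrt_le_one]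
  exact kwonCutoff_le_one x

/-- `W` is (a.e. strongly) measurable when `U` is. [folklore] -/
theorem aestronglyMeasurable_sqrtCutoffSMul {μ : Measure (EuclideanSpace ℝ (Fin 3))}
    (hU : AEStronglyMeasurable U μ) : AEStronglyMeasurable (sqrtCutoffSMul U) μ :=
  (Real.continuous_sqrt.comp (contDiff_kwonCutoff (n := 0)).continuous).aestronglyMeasurable.smul hU

/-- `W ∈ L³` when `U ∈ L³`. [folklore] -/
theorem memLp_sqrtCutoffSMul (hU : MemLp U 3 volume) : MemLp (sqrtCutoffSMul U) 3 volume :=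
  hU.of_le (aestronglyMeasurable_sqrtCutoffSMul hU.1) (Eventually.of_forall norm_sqrtCutoffSMul_le)

/-- `‖W‖₃ ≤ ‖U‖₃`. [folklore] -/
theorem eLpNorm_sqrtCutoffSMul_le {p : ℝ≥0∞} :
    eLpNorm (sqrtCutoffSMul U) p volume ≤ eLpNorm U p volume :=
  eLpNorm_mono fun x => norm_sqrtCutoffSMul_le x

/-! ### The pairing symmetry of `Λ` against an `L¹_loc` function -/

/-- **`∫ P Λ[σ] = ∫ Λ[P] σ`** for `P` locally integrable and `σ ∈ C_c` (the kernel `λ` is even,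
Fubini; the tree's `integral_smul_convolution_eq`). [folklore] -/
theorem integral_mul_newtonFarSmoothing_comm_loc {P σ : EuclideanSpace ℝ (Fin 3) → ℝ}
    (hP : LocallyIntegrable P volume) (hσ : Continuous σ) (hσc : HasCompactSupport σ) :
    ∫ x, P x * newtonFarSmoothing 3 4 σ x = ∫ x, newtonFarSmoothing 3 4 P x * σ x := by
  have h := integral_smul_convolution_eq (F := ℝ) (continuous_newtonFarLaplacian (by norm_num)
    (by norm_num)) (hasCompactSupport_newtonFarLaplacian (by norm_num) (by norm_num))
    (newtonFarLaplacian_neg (r₀ := 3) (r₁ := 4) (by norm_num) (by norm_num)) hσ hσc hP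
  simp only [smul_eq_mul, ← newtonFarSmoothing_eq_convolution] at h
  calc ∫ x, P x * newtonFarSmoothing 3 4 σ x = ∫ x, newtonFarSmoothing 3 4 σ x * P x := by
        simp_rw [mul_comm]
    _ = ∫ x, σ x * newtonFarSmoothing 3 4 P x := h.symm
    _ = ∫ x, newtonFarSmoothing 3 4 P x * σ x := by simp_rw [mul_comm]

/-! ### The Calderón–Zygmund term as a pressure -/

variable (U) in
/-- **Kwon's Calderón–Zygmund pressure piece of a slice**: `q₀ = Π[W] − Λ[Π[W]]`, `W = √φ U`,
`Π` the Riesz pressure operator `L³ → L^{3/2}` of the tree (`rieszPressure`: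
`ΔΠ[W] = −∂ᵢ∂ⱼ(WᵢWⱼ)`), `Λ` the smoothing remainder of the truncated potential. This is the
`L^{3/2}` part `−Δ⁻¹ div div(φ u ⊗ u)`-type term of Kwon's `q` (there written
`−Δ⁻¹div(φ ω × u) − ½|v|² − …`). [cite: Kwon2023RolePressure, Lemma 2.5 (proof, p. 8)] -/
def czPressure (x : EuclideanSpace ℝ (Fin 3)) : ℝ :=
  rieszPressure (sqrtCutoffSMul U) x - newtonFarSmoothing 3 4 (rieszPressure (sqrtCutoffSMul U)) x

/-- **`∫ φ D²(div A_ξ)(U, U) = −∫ q₀ div ξ`** for `U ∈ L³(ℝ³; ℝ³)` and a test field `ξ`: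
`φ D²Π_ξ(U,U) = D²Π_ξ(W,W)`, the weak Poisson equation of the Riesz pressure
`∫ Π[W] ΔΠ_ξ = −∫ D²Π_ξ(W, W)` (`integral_rieszPressure_mul_laplacian`) with the test function
`Π_ξ = div A_ξ ∈ C_c^∞`, `ΔΠ_ξ = div ξ − Λ[div ξ]`, and the pairing symmetry of `Λ`.
[cite: Kwon2023RolePressure, Lemma 2.5 (proof, p. 8)] -/
theorem integral_cutoff_mul_hessian_divergence_testPotential (hU : MemLp U 3 volume)
    (hξ : ContDiff ℝ ∞ ξ) (hξc : HasCompactSupport ξ) :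
    ∫ x, kwonCutoff x * fderiv ℝ (fderiv ℝ (VectorCalculus.divergence (testPotential ξ))) x
        (U x) (U x) =
      -∫ x, czPressure U x * VectorCalculus.divergence ξ x := by
  have h32 : (1 : ℝ≥0∞) ≤ 3 / 2 := by
    rw [ENNReal.le_div_iff_mul_le (by norm_num) (by norm_num)]; norm_num
  haveI : Fact ((1 : ℝ≥0∞) ≤ 3 / 2) := ⟨h32⟩
  have hW : MemLp (sqrtCutoffSMul U) 3 volume := memLp_sqrtCutoffSMul hU
  set P : EuclideanSpace ℝ (Fin 3) → ℝ := rieszPressure (sqrtCutoffSMul U) with hPdef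
  have hPmem : MemLp P (3 / 2 : ℝ≥0∞) volume := memLp_rieszPressure hW
  have hPloc : LocallyIntegrable P volume := hPmem.locallyIntegrable h32
  have hPi : ContDiff ℝ (⊤ : ℕ∞) (VectorCalculus.divergence (testPotential ξ)) :=
    contDiff_divergence_testPotential hξ hξc
  have hPic : HasCompactSupport (VectorCalculus.divergence (testPotential ξ)) :=
    hasCompactSupport_divergence_testPotential hξc
  have hσ : Continuous fun y => VectorCalculus.divergence ξ y := by
    rw [show (fun y => VectorCalculus.divergence ξ y) = traceCLM ∘ fderiv ℝ ξ from
      divergence_eq_traceCLM_comp ξ]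
    exact traceCLM.continuous.comp ((contDiff_infty.1 hξ 1).continuous_fderiv one_ne_zero)
  have hσc : HasCompactSupport fun y => VectorCalculus.divergence ξ y := by
    rw [show (fun y => VectorCalculus.divergence ξ y) = traceCLM ∘ fderiv ℝ ξ from
      divergence_eq_traceCLM_comp ξ]
    exact (hξc.fderiv (𝕜 := ℝ)).comp_left (map_zero _)
  have hΛσ : Continuous (newtonFarSmoothing 3 4 fun y => VectorCalculus.divergence ξ y) :=
    continuous_newtonFarSmoothing (by norm_num) (by norm_num) hσ
  have hΛσc : HasCompactSupport (newtonFarSmoothing 3 4 fun y => VectorCalculus.divergence ξ y) :=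
    hasCompactSupport_newtonFarSmoothing (by norm_num) (by norm_num) hσc
  -- (1) `φ D²Π(U,U) = D²Π(W,W)` and the weak Poisson equation
  have e1 : ∫ x, kwonCutoff x * fderiv ℝ (fderiv ℝ (VectorCalculus.divergence (testPotential ξ))) x
      (U x) (U x) = -∫ x, P x * (Δ (VectorCalculus.divergence (testPotential ξ))) x := by
    rw [integral_rieszPressure_mul_laplacian hW hPi hPic, neg_neg]
    refine integral_congr_ae (Eventually.of_forall fun x => ?_)
    exact (hessian_sqrtCutoffSMul _ x).symm
  -- (2) `ΔΠ = σ − Λσ` and the symmetry of `Λ`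
  have hi1 : Integrable fun x => P x * VectorCalculus.divergence ξ x := by
    simpa only [smul_eq_mul, mul_comm] using hPloc.integrable_smul_left_of_hasCompactSupport hσ hσc
  have hi2 : Integrable fun x => P x *
      newtonFarSmoothing 3 4 (fun y => VectorCalculus.divergence ξ y) x := by
    simpa only [smul_eq_mul, mul_comm] using hPloc.integrable_smul_left_of_hasCompactSupport hΛσ hΛσc
  have e2 : ∫ x, P x * (Δ (VectorCalculus.divergence (testPotential ξ))) x =
      (∫ x, P x * VectorCalculus.divergence ξ x)
        - ∫ x, newtonFarSmoothing 3 4 P x * VectorCalculus.divergence ξ x := by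
    rw [← integral_mul_newtonFarSmoothing_comm_loc hPloc hσ hσc, ← integral_sub hi1 hi2]
    refine integral_congr_ae (Eventually.of_forall fun x => ?_)
    show P x * (Δ (VectorCalculus.divergence (testPotential ξ))) x = P x * VectorCalculus.divergence ξ x
      - P x * newtonFarSmoothing 3 4 (fun y => VectorCalculus.divergence ξ y) x
    rw [laplacian_divergence_testPotential hξ hξc x, mul_sub]
  have hi3 : Integrable fun x => newtonFarSmoothing 3 4 P x * VectorCalculus.divergence ξ x := by
    have hΛP : Continuous (newtonFarSmoothing 3 4 P) := by
      rw [newtonFarSmoothing_eq_convolution]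
      exact (hasCompactSupport_newtonFarLaplacian (by norm_num) (by norm_num)).continuous_convolution_left
        _ (continuous_newtonFarLaplacian (by norm_num) (by norm_num)) hPloc
    exact (hΛP.mul hσ).integrable_of_hasCompactSupport hσc.mul_left
  rw [e1, e2]
  congr 1
  rw [← integral_sub hi1 hi3]
  refine integral_congr_ae (Eventually.of_forall fun x => ?_)
  show P x * VectorCalculus.divergence ξ x - newtonFarSmoothing 3 4 P x * VectorCalculus.divergence ξ x
    = czPressure U x * VectorCalculus.divergence ξ x
  rw [← sub_mul]
  rfl

end Kwon2023

end Literature.Analysis.FluidPDE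

end
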